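import Summits.ABC.ABC.Theorems.SomeWindowSaving.Negative.LoadBearing
import Literature.NumberTheory.EllipticCurves.SzpiroLocalDataProofs
import Literature.Barriers.ABC.UniformABCDiscriminantSharpProofs

/-!
# `ModerateWindowCount` (stmt-ABC-1973, route ABC/TwistAmplification) — negative-side lemmas I:
# the crux through the landed window count, its degenerate case, the honesty clause `κ < σ`, counting tools

Standing-adversary (cdisprove) output for the crux
`Summit.ABC.ABC.Theses.TwistAmplification.ModerateWindowCount`
(`∀ σ > 6 ∃ κ ∈ (3,σ) ∃ δ < (σ−κ)/(2σ−6) ∃ C ∀ X ≥ 1, T_[κ,σ](X) ≤ C X^δ`). The counted set is the SAME as the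
sibling crux's (`SomeWindowSaving`, stmt-ABC-1976), so this file states everything over the landed
`windowSet` / `windowCount` / `windowSet_finite` / `not_mem_windowSet_of_maxInv_le_one`
(`Theorems/SomeWindowSaving/Negative/{Defs,WindowFinite,LoadBearing}.lean`) — no second copy of the set.

* §1 monotonicity (`windowSet_mono`, `windowCount_mono`, `…_mono_X`, `mem_windowSet_of_conductor_le`). That the
  crux is LITERALLY `∀ σ>6 ∃ κ δ C, … windowCount κ σ X ≤ C X^δ` is the landed `Iff.rfl`
  `Summit.ABC.ABC.Theorems.moderateWindowCount_iff` (`Theorems/TwistAmplificationModerateWindowCountInertBox.lean`,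
  the line lead's Theorems-side form of this adversary's §3), not restated here.
* §2 `two_le_maxInv_of_mem`, `two_le_conductor_of_mem` (conductor-`1` curves never enter a window),
  `windowSet_eq_empty_of_lt` (`σ < κ` ⇒ empty) and the HONESTY clause
  `moderateWindowCountWithoutKappaLtSigma_trivial`: with `κ < σ` dropped the crux is provable outright
  (`κ := σ + 1`, `δ := −1`, `C := 0`) — the `∀σ ∃κ` analogue of the landed
  `someWindowSaving_trivial_without_upperSigma`.
* Counting tools shared by the companion files: `card_le_windowCount_of_forall_mem` (an injectively labelled
  family of members bounds the count from below) and the Chebyshev prime supply `primesIoc_card_mul_log_ge`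
  with explicit thresholds (`T/4 ≤ #{A < p ≤ T} · log T` for `T ≥ T₀`, `T ≥ 6A + 1`; from
  `Literature.Barriers.ABC.eventually_theta_ge_half` and Mathlib's `Chebyshev.theta_le_log4_mul_x`).

Companion files: `TwistFamily` (reduced twisted Frey models, exact conductor), `TwistWindow` (membership,
exponents), `SixSharpCore` + `SixLtSigmaSharp` (`6 < σ` is sharp; no window law below `1 − κ/6` for ALL
`3 < κ < σ ≤ 6`, strengthening the landed `no_witness_of_sigma_le_six` of the sibling crux to "no witness with
`σ ≤ 6` at all"), `NoMinFamily` + `NoMinimality` (minimality is load-bearing), `Unreduced` (reducedness is an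
honesty clause). No statement of the route is asserted positively. Refuter seat
refuter-cdisprove-stmt-ABC-1973-0, 2026-08-16 (resubmission of p85602 along the reviewer's points 1–2).
-/

namespace Summit.ABC.ABC.Theorems.ModerateWindowCount.Negative

open Summit.ABC.ABC.Theses.TwistAmplification WeierstrassCurve IsDedekindDomain
open Summit.ABC.ABC.Theorems.SomeWindowSaving.Negative

noncomputable section

/-! ## 1. The counted set: the crux through the landed `windowSet` / `windowCount`
(`Theorems/SomeWindowSaving/Negative/Defs.lean`, same route, same set verbatim), monotonicity -/

/-! ### 1.2 Monotonicity -/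

/-- The conductor of a window member is `≥ 1` (as a real number). [folklore] -/
theorem one_le_conductor_of_mem {κ σ X : ℝ} {W : WeierstrassCurve ℤ} (hW : W ∈ windowSet κ σ X) :
    (1 : ℝ) ≤ (((W.baseChange ℚ).conductorNorm ℤ : ℕ) : ℝ) := by
  haveI := hW.1
  exact_mod_cast conductorNorm_pos_holds (W.baseChange ℚ)

/-- Windows grow when `κ` decreases and `σ` increases. [folklore] -/
theorem windowSet_mono {κ κ' σ σ' : ℝ} (hκ : κ' ≤ κ) (hσ : σ ≤ σ') (X : ℝ) :
    windowSet κ σ X ⊆ windowSet κ' σ' X := by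
  intro W hW
  have h1 := one_le_conductor_of_mem hW
  obtain ⟨hE, hmin, h₁, h₃, h₂, hc₄, hc₆, hNX, hlo, hhi⟩ := hW
  refine ⟨hE, hmin, h₁, h₃, h₂, hc₄, hc₆, hNX, ?_, ?_⟩
  · exact (Real.rpow_le_rpow_of_exponent_le h1 hκ).trans hlo
  · exact hhi.trans (Real.rpow_le_rpow_of_exponent_le h1 hσ)

/-- Membership only uses `N ≤ X`. [folklore] -/
theorem mem_windowSet_of_conductor_le {κ σ X Y : ℝ} {W : WeierstrassCurve ℤ} (hW : W ∈ windowSet κ σ X)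
    (hY : (((W.baseChange ℚ).conductorNorm ℤ : ℕ) : ℝ) ≤ Y) : W ∈ windowSet κ σ Y := by
  obtain ⟨hE, hmin, h₁, h₃, h₂, hc₄, hc₆, -, hlo, hhi⟩ := hW
  exact ⟨hE, hmin, h₁, h₃, h₂, hc₄, hc₆, hY, hlo, hhi⟩

/-- Windows grow with `X`. [folklore] -/
theorem windowSet_mono_X (κ σ : ℝ) {X X' : ℝ} (hX : X ≤ X') : windowSet κ σ X ⊆ windowSet κ σ X' :=
  fun _ hW => mem_windowSet_of_conductor_le hW (hW.2.2.2.2.2.2.2.1.trans hX)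

/-- `windowCount` is antitone in `κ` and monotone in `σ`. [folklore] -/
theorem windowCount_mono {κ κ' σ σ' : ℝ} (hκ : κ' ≤ κ) (hσ : σ ≤ σ') (X : ℝ) :
    windowCount κ σ X ≤ windowCount κ' σ' X :=
  Set.ncard_le_ncard (windowSet_mono hκ hσ X) (windowSet_finite _ _ _)

/-- `windowCount` is monotone in `X`. [folklore] -/
theorem windowCount_mono_X (κ σ : ℝ) {X X' : ℝ} (hX : X ≤ X') : windowCount κ σ X ≤ windowCount κ σ X' :=
  Set.ncard_le_ncard (windowSet_mono_X κ σ hX) (windowSet_finite _ _ _)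


/-! ## 2. Degenerate cases: conductor `1`, windows with `σ < κ`, and the honesty clause `κ < σ`

The only degenerate instance of the counted predicate is `N = 1` (then `N^κ = N^σ = 1` for all real
exponents and the window condition reads `M⁺ = 1`); it is EMPTY by the landed
`not_mem_windowSet_of_maxInv_le_one` (`Theorems/SomeWindowSaving/Negative/LoadBearing.lean`: an integral
model with `Δ ≠ 0`, `c₄ ≠ 0`, `max |Δ| |c₄|³ = 1` would have `c₆² = c₄³ − 1728Δ ∈ {±1727, ±1729}`).
Consequence: a window with `σ < κ` is empty, so the clause `κ < σ` of the crux is exactly what keeps the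
statement from being trivially true (the `∀σ ∃κ` analogue of `someWindowSaving_trivial_without_upperSigma`). -/

/-- Window members have `M⁺ ≥ 2` (from the landed `not_mem_windowSet_of_maxInv_le_one`:
`M⁺ = 1` would force `|Δ| = |c₄| = 1`, and `c₆² = c₄³ − 1728Δ ∈ {±1727, ±1729}` has no solution). [folklore] -/
theorem two_le_maxInv_of_mem {κ σ X : ℝ} {W : WeierstrassCurve ℤ} (hW : W ∈ windowSet κ σ X) :
    (2 : ℝ) ≤ ((max |W.Δ| (|W.c₄| ^ 3) : ℤ) : ℝ) := by
  by_contra h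
  push Not at h
  have h1 : max |W.Δ| (|W.c₄| ^ 3) ≤ 1 := by
    have : ((max |W.Δ| (|W.c₄| ^ 3) : ℤ) : ℝ) < ((2 : ℤ) : ℝ) := by exact_mod_cast h
    have := (Int.cast_lt (R := ℝ)).mp this
    omega
  exact not_mem_windowSet_of_maxInv_le_one hW (by exact_mod_cast h1)

/-- Window members have conductor `N ≥ 2` (as a real number): `N = 1` would force `M⁺ = 1`. [folklore] -/
theorem two_le_conductor_of_mem {κ σ X : ℝ} {W : WeierstrassCurve ℤ} (hW : W ∈ windowSet κ σ X) :
    (2 : ℝ) ≤ (((W.baseChange ℚ).conductorNorm ℤ : ℕ) : ℝ) := by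
  have h1 := one_le_conductor_of_mem hW
  have hM := two_le_maxInv_of_mem hW
  obtain ⟨-, -, -, -, -, -, -, -, -, hhi⟩ := hW
  set N : ℕ := (W.baseChange ℚ).conductorNorm ℤ with hN
  have hN1 : 1 ≤ N := by exact_mod_cast h1
  rcases hN1.eq_or_lt with h | h
  · exfalso
    rw [← h] at hhi
    simp only [Nat.cast_one, Real.one_rpow] at hhi
    linarith
  · have : 2 ≤ N := h
    exact_mod_cast this

/-- **Windows with `σ < κ` are empty.** [folklore] -/
theorem windowSet_eq_empty_of_lt {κ σ : ℝ} (h : σ < κ) (X : ℝ) : windowSet κ σ X = ∅ := by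
  ext W
  simp only [Set.mem_empty_iff_false, iff_false]
  intro hW
  have h2 := two_le_conductor_of_mem hW
  obtain ⟨-, -, -, -, -, -, -, -, hlo, hhi⟩ := hW
  have : (((W.baseChange ℚ).conductorNorm ℤ : ℕ) : ℝ) ^ σ <
      (((W.baseChange ℚ).conductorNorm ℤ : ℕ) : ℝ) ^ κ :=
    Real.rpow_lt_rpow_of_exponent_lt (by linarith) h
  linarith

/-- `windowCount κ σ X = 0` when `σ < κ`. [folklore] -/
theorem windowCount_eq_zero_of_lt {κ σ : ℝ} (h : σ < κ) (X : ℝ) : windowCount κ σ X = 0 := by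
  rw [windowCount, windowSet_eq_empty_of_lt h, Set.ncard_empty]

/-- The crux with the clause `κ < σ` dropped. -/
def ModerateWindowCountWithoutKappaLtSigma : Prop :=
  ∀ σ : ℝ, 6 < σ → ∃ κ δ C : ℝ, 3 < κ ∧ δ < (σ - κ) / (2 * σ - 6) ∧
    ∀ X : ℝ, 1 ≤ X → (windowCount κ σ X : ℝ) ≤ C * X ^ δ

/-- **HONESTY CLAUSE `κ < σ`.** Without it the crux is provable outright: take `κ := σ + 1` (empty
windows), `δ := −1 < −1/(2σ−6)`, `C := 0`. So any purported proof of the crux that never uses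
`κ < σ` in an essential way has proved nothing. [folklore] -/
theorem moderateWindowCountWithoutKappaLtSigma_trivial : ModerateWindowCountWithoutKappaLtSigma := by
  intro σ hσ
  refine ⟨σ + 1, -1, 0, by linarith, ?_, fun X _ => ?_⟩
  · have h26 : (6 : ℝ) < 2 * σ - 6 := by linarith
    rw [lt_div_iff₀ (by linarith)]
    linarith
  · rw [windowCount_eq_zero_of_lt (by linarith)]
    simp


/-! #### Counting tools -/

/-- A finite family of window members, injectively labelled, bounds `T` from below. [folklore] -/
theorem card_le_windowCount_of_forall_mem {κ σ X : ℝ} (S : Finset ℕ) (F : ℕ → WeierstrassCurve ℤ)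
    (hinj : Set.InjOn F ↑S) (hmem : ∀ d ∈ S, F d ∈ windowSet κ σ X) : S.card ≤ windowCount κ σ X := by
  classical
  have hsub : (↑(S.image F) : Set (WeierstrassCurve ℤ)) ⊆ windowSet κ σ X := by
    intro W hW
    rw [Finset.coe_image] at hW
    obtain ⟨d, hd, rfl⟩ := hW
    exact hmem d hd
  have h1 : S.card = (S.image F).card := (Finset.card_image_of_injOn hinj).symm
  have h2 : (S.image F).card = Set.ncard (↑(S.image F) : Set (WeierstrassCurve ℤ)) :=
    (Set.ncard_coe_finset _).symm
  have h3 := Set.ncard_le_ncard hsub (windowSet_finite _ _ _)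
  unfold windowCount; rw [h1, h2]; exact h3

/-! #### Prime supply (Chebyshev): `#{A < p ≤ T} · log T ≥ T/4` for `T ≥ T₀`, `T ≥ 6A + 1` -/

/-- The primes in `(A, T]`. [folklore] -/
def primesIoc (A T : ℕ) : Finset ℕ := (Finset.Ioc A T).filter Nat.Prime

open Chebyshev in
/-- `θ(T) = θ(A) + Σ_{A < p ≤ T} log p`. [folklore] -/
theorem theta_split_gen {A T : ℕ} (hT : A ≤ T) :
    θ (T : ℝ) = θ (A : ℝ) + ∑ p ∈ primesIoc A T, Real.log p := by
  rw [theta_eq_sum_primesLE_log T, theta_eq_sum_primesLE_log A]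
  have hU : Nat.primesLE T = Nat.primesLE A ∪ primesIoc A T := by
    ext p
    simp only [Nat.mem_primesLE, primesIoc, Finset.mem_union, Finset.mem_filter, Finset.mem_Ioc]
    constructor
    · rintro ⟨hpT, hp⟩
      by_cases h : p ≤ A
      · exact Or.inl ⟨h, hp⟩
      · exact Or.inr ⟨⟨by omega, hpT⟩, hp⟩
    · rintro (⟨h, hp⟩ | ⟨⟨-, h⟩, hp⟩)
      · exact ⟨h.trans hT, hp⟩
      · exact ⟨h, hp⟩
  have hD : Disjoint (Nat.primesLE A) (primesIoc A T) := by
    rw [Finset.disjoint_left]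
    intro p hp hp'
    rw [Nat.mem_primesLE] at hp
    rw [primesIoc, Finset.mem_filter, Finset.mem_Ioc] at hp'
    omega
  rw [hU, Finset.sum_union hD]

/-- `Σ_{A < p ≤ T} log p ≤ #{A < p ≤ T} · log T`. [folklore] -/
theorem sum_log_primesIoc_le (A T : ℕ) :
    ∑ p ∈ primesIoc A T, Real.log p ≤ (primesIoc A T).card * Real.log T := by
  have h : ∀ p ∈ primesIoc A T, Real.log p ≤ Real.log T := by
    intro p hp
    rw [primesIoc, Finset.mem_filter, Finset.mem_Ioc] at hp
    exact Real.log_le_log (by exact_mod_cast hp.2.pos) (by exact_mod_cast hp.1.2)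
  calc ∑ p ∈ primesIoc A T, Real.log p ≤ ∑ _p ∈ primesIoc A T, Real.log T := Finset.sum_le_sum h
    _ = (primesIoc A T).card * Real.log T := by rw [Finset.sum_const, nsmul_eq_mul]

open Chebyshev in
/-- **Prime supply** with explicit thresholds (Chebyshev, via `eventually_theta_ge_half` and Mathlib's
`theta_le_log4_mul_x`). [folklore] -/
theorem primesIoc_card_mul_log_ge :
    ∃ T₀ : ℕ, ∀ A T : ℕ, T₀ ≤ T → 6 * A + 1 ≤ T → (T : ℝ) / 4 ≤ (primesIoc A T).card * Real.log T := by
  obtain ⟨T₀, hT₀⟩ := Literature.Barriers.ABC.eventually_theta_ge_half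
  refine ⟨T₀, fun A T hT hTA => ?_⟩
  have h1 := hT₀ T hT
  have h2 := theta_split_gen (A := A) (T := T) (by omega)
  have h3 := sum_log_primesIoc_le A T
  have h4 : θ (A : ℝ) ≤ Real.log 4 * (A : ℝ) := theta_le_log4_mul_x (by positivity)
  have hlog4 : Real.log 4 < 1.3863 := by
    have : Real.log 4 = 2 * Real.log 2 := by
      rw [show (4 : ℝ) = 2 ^ 2 by norm_num, Real.log_pow]; norm_num
    rw [this]
    have := Real.log_two_lt_d9
    linarith
  have hT' : 6 * (A : ℝ) + 1 ≤ T := by exact_mod_cast hTA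
  have hA0 : (0 : ℝ) ≤ A := by positivity
  have h5 : Real.log 4 * (A : ℝ) ≤ 1.3863 * A := mul_le_mul_of_nonneg_right hlog4.le hA0
  nlinarith

end

end Summit.ABC.ABC.Theorems.ModerateWindowCount.Negative
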